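import Summits.QuantumAdvantage.QuantumAdvantage.Theorems.MultiRingBridge
import Summits.QuantumAdvantage.QuantumAdvantage.Theses.SpreadDial
import Summits.QuantumAdvantage.AdviceFreeQNC0.AdviceFreeQNC0Three
import Literature.Computability.MetaComplexity.SmolenskyCorrelationRestrict
import HarnessLib

/-!
# The hybrid lemma: foreign-spread loss ⇒ many-ring hardness (item stmt-QuantumAdvantage-29066 `SpreadBridge3` PROVED)

Cell decomp-qadv, seat lens-5 («finite range + asymptotic regime + bridge»), generation 8 (land port of the
generation-5 node proof `multiRingHard3_of_spreadLoss3`, node sha256 a60f627b…, attached as evidence on the item).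

`Theses.SpreadDial.SpreadBridge3 : SpreadLoss3 → MultiRingHard3` is a load-bearing binder of route SpreadDial's
`closes`.  Proof (a hybrid / one-ring-at-a-time argument, `K := k`, `θ := 1 - min η 1 / 2`):
process the `m = n^k` rings one at a time; on each fibre `{update X j y | y}` the already-processed rings' wins form
a FOREIGN WIN EVENT for ring `j` (their patterns are fixed on the fibre, their outputs restricted to the fibre stay
low-degree by `Smolensky.comp_subst_mem_lowDeg`), so the spread hypothesis removes a `d = n^{-k}` fraction of the
fibre whenever the event is dense: `a_{t+1} ≤ (1-d)·a_t + d(1-η)·2^{mn}` (`card_winAllSet_le_hybrid`), and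
`(1 - n^{-k})^{n^k} ≤ 1/2` (`decay_le_half`).

Main results: `SpreadBridge.card_winAllSet_le_hybrid` (the hybrid lemma at one length, explicit binders, no new
`Prop`), `spreadDial_spreadBridge3 : Theses.SpreadDial.SpreadBridge3` (closes the item by exact type), and
`spreadDial_closes₂ : PolyLoss3 → CoverLift3 → AdviceFreeQNC0Three` (SpreadDial's `closes` with BOTH bridge binders
discharged, using the landed `spreadDial_multiRingBridge3`).
-/

set_option linter.dupNamespace false

namespace Summit.QuantumAdvantage.QuantumAdvantage.Theorems

open Finset
open Literature.Computability.QuantumComplexity Literature.Computability.MetaComplexity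

namespace SpreadBridge

/-- A JOINT strategy for `m` rings of length `n`: every output reads all `m·n` bits. [bookkeeping] -/
abbrev JointStrategy (m n : ℕ) : Type := Fin m → Fin n → Smolensky.CubeFn (ZMod 3) (m * n)

/-- The set of input tuples on which the joint strategy wins ALL rings (inputs flattened by the tree's `flat`). [bookkeeping] -/
noncomputable def winAllSet {m n : ℕ} (P : JointStrategy m n) : Finset (Fin m → Fin n → Bool) :=
  univ.filter fun X => ∀ j, RingHLF.Rel (X j) (fun i => decide (P j i (flat X) = 1))

/-- Averaging over one coordinate: summing, over all tuples `X`, the number of values `y` of coordinate `j`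
for which `Φ (update X j y)` holds counts every tuple satisfying `Φ` exactly `|α|` times. [bookkeeping] -/
theorem sum_card_filter_update {ι α : Type*} [Fintype ι] [DecidableEq ι] [Fintype α] [DecidableEq α]
    (j : ι) (Φ : (ι → α) → Prop) [DecidablePred Φ] :
    ∑ X : ι → α, (univ.filter fun y : α => Φ (Function.update X j y)).card =
      Fintype.card α * (univ.filter Φ).card := by
  set e := Equiv.funSplitAt j α with he
  have hupd : ∀ (X : ι → α) (y : α), Function.update X j y = e.symm (y, (e X).2) := by
    intro X y
    funext i
    by_cases hi : i = j
    · subst hi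
      simp [he, Equiv.funSplitAt, Equiv.piSplitAt]
    · simp [he, Equiv.funSplitAt, Equiv.piSplitAt, hi]
  let g : ({i // i ≠ j} → α) → ℕ := fun r => (univ.filter fun y : α => Φ (e.symm (y, r))).card
  calc ∑ X : ι → α, (univ.filter fun y : α => Φ (Function.update X j y)).card
      = ∑ X : ι → α, g (e X).2 := by
        refine Finset.sum_congr rfl fun X _ => ?_
        simp only [g, hupd]
    _ = ∑ p : α × ({i // i ≠ j} → α), g p.2 := by
        rw [← e.symm.sum_comp (fun X => g (e X).2)]
        simp only [Equiv.apply_symm_apply]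
    _ = ∑ _a : α, ∑ r : {i // i ≠ j} → α, g r := Fintype.sum_prod_type _
    _ = Fintype.card α * ∑ r : {i // i ≠ j} → α, g r := by
        rw [Finset.sum_const, Finset.card_univ, smul_eq_mul]
    _ = Fintype.card α * (univ.filter Φ).card := by
        congr 1
        have h1 : (univ.filter Φ).card
            = (univ.filter fun p : α × ({i // i ≠ j} → α) => Φ (e.symm p)).card := by
          refine Finset.card_equiv e (fun X => ?_)
          simp only [mem_filter, mem_univ, true_and, Equiv.symm_apply_apply]
        rw [h1, Finset.card_filter, Fintype.sum_prod_type]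
        simp only [g, Finset.card_filter]
        exact Finset.sum_comm

/-- The fibrewise decrement: `a + ℓ = e ≤ N`, and the spread hypothesis `(1-η)N ≤ e → dN ≤ ℓ`, give
`a ≤ (1-d)e + d(1-η)N`. [arithmetic] -/
theorem fibre_decrement {a l e N d η : ℝ} (hsum : a + l = e) (heN : e ≤ N) (hl : 0 ≤ l)
    (hN : 0 ≤ N) (hd : 0 ≤ d) (hη : η ≤ 1) (h : (1 - η) * N ≤ e → d * N ≤ l) :
    a ≤ (1 - d) * e + d * ((1 - η) * N) := by
  by_cases hc : (1 - η) * N ≤ e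
  · have h1 := h hc
    have h2 : d * e ≤ d * N := mul_le_mul_of_nonneg_left heN hd
    have h3 : d * (η * N) ≤ d * N := mul_le_mul_of_nonneg_left (by nlinarith) hd
    nlinarith
  · rw [not_le] at hc
    have h2 : d * e ≤ d * ((1 - η) * N) := mul_le_mul_of_nonneg_left hc.le hd
    nlinarith

/-- **The hybrid lemma** (m rings, any degree bound `D`, loss rate `d`, density threshold `1-η`): if every
single-ring strategy of degree `≤ D` keeps `d·2^n` losses inside every foreign win event of density `≥ 1-η` cut
out by `< m` foreign rings, then every JOINT degree-`≤ D` strategy for `m` rings wins all rings on at most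
`((1-η) + η(1-d)^m)·2^(m·n)` input tuples. [kernel] -/
theorem card_winAllSet_le_hybrid {n m D : ℕ} {η d : ℝ} (hη1 : η ≤ 1) (hd0 : 0 ≤ d) (hd1 : d ≤ 1)
    (P : JointStrategy m n) (hP : ∀ j i, P j i ∈ Smolensky.lowDeg (ZMod 3) (m * n) D)
    (hS : ∀ Pv : Fin n → Smolensky.CubeFn (ZMod 3) n, (∀ i, Pv i ∈ Smolensky.lowDeg (ZMod 3) n D) →
      ∀ t : ℕ, t < m → ∀ w : Fin t → Fin n → Bool, ∀ Q : Fin t → Fin n → Smolensky.CubeFn (ZMod 3) n,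
        (∀ s i, Q s i ∈ Smolensky.lowDeg (ZMod 3) n D) →
        (1 - η) * (2 : ℝ) ^ n ≤ ((univ.filter fun y : Fin n → Bool =>
            ∀ s, RingHLF.Rel (w s) (fun i => decide (Q s i y = 1))).card : ℝ) →
        d * (2 : ℝ) ^ n ≤ ((univ.filter fun y : Fin n → Bool =>
            (∀ s, RingHLF.Rel (w s) (fun i => decide (Q s i y = 1))) ∧
              ¬ RingHLF.Rel y (fun i => decide (Pv i y = 1))).card : ℝ)) :
    ((winAllSet P).card : ℝ) ≤ ((1 - η) + η * (1 - d) ^ m) * (2 : ℝ) ^ (m * n) := by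
  classical
  -- sizes
  set N : ℝ := (2 : ℝ) ^ n with hN
  set M : ℝ := (2 : ℝ) ^ (m * n) with hM
  have hNpos : 0 < N := by positivity
  have hN0 : 0 ≤ N := hNpos.le
  have hcardY : (Fintype.card (Fin n → Bool) : ℝ) = N := by
    rw [Fintype.card_fun, Fintype.card_bool, Fintype.card_fin]; push_cast; rfl
  have hcardX : (Fintype.card (Fin m → Fin n → Bool) : ℝ) = M := by
    rw [Fintype.card_fun, Fintype.card_fun, Fintype.card_bool, Fintype.card_fin, Fintype.card_fin]
    push_cast; rw [← pow_mul, mul_comm]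
  -- win predicate of ring `s` and the hybrid sets `A t` (rings `< t` win)
  let Win : Fin m → (Fin m → Fin n → Bool) → Prop := fun s X =>
    RingHLF.Rel (X s) (fun i => decide (P s i (flat X) = 1))
  let A : ℕ → Finset (Fin m → Fin n → Bool) := fun t =>
    univ.filter fun X => ∀ s : Fin m, (s : ℕ) < t → Win s X
  -- one hybrid step
  have hstep : ∀ t : ℕ, t < m →
      ((A (t + 1)).card : ℝ) ≤ (1 - d) * ((A t).card : ℝ) + d * ((1 - η) * M) := by
    intro t ht
    let j : Fin m := ⟨t, ht⟩
    have hupd_ne : ∀ (X : Fin m → Fin n → Bool) (y : Fin n → Bool) (s : Fin m), (s : ℕ) < t →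
        Function.update X j y s = X s := by
      intro X y s hs
      apply Function.update_of_ne
      intro hsj
      rw [hsj] at hs
      exact lt_irrefl _ hs
    -- fibrewise bound
    have hfib : ∀ X : Fin m → Fin n → Bool,
        ((univ.filter fun y : Fin n → Bool =>
            ∀ s : Fin m, (s : ℕ) < t + 1 → Win s (Function.update X j y)).card : ℝ)
          ≤ (1 - d) * ((univ.filter fun y : Fin n → Bool =>
            ∀ s : Fin m, (s : ℕ) < t → Win s (Function.update X j y)).card : ℝ) + d * ((1 - η) * N) := by
      intro X
      -- the substitution `y ↦ flat (update X j y)` fixes every coordinate outside ring `j`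
      let emb : (Fin n → Bool) → (Fin (m * n) → Bool) := fun y => flat (Function.update X j y)
      have hemb : ∀ kk, (∃ b, ∀ u, emb u kk = b) ∨ (∃ s, ∀ u, emb u kk = u s) := by
        intro kk
        simp only [emb, flat]
        generalize finProdFinEquiv.symm kk = q
        obtain ⟨r, s⟩ := q
        by_cases hr : r = j
        · right
          refine ⟨s, fun u => ?_⟩
          rw [hr, Function.update_self]
        · left
          refine ⟨X r s, fun u => ?_⟩
          rw [Function.update_of_ne hr]
      let Pv : Fin n → Smolensky.CubeFn (ZMod 3) n := fun i y => P j i (emb y)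
      have hPv : ∀ i, Pv i ∈ Smolensky.lowDeg (ZMod 3) n D := fun i =>
        Smolensky.comp_subst_mem_lowDeg emb hemb (hP j i)
      let w : Fin t → Fin n → Bool := fun s => X ⟨s, lt_trans s.isLt ht⟩
      let Q : Fin t → Fin n → Smolensky.CubeFn (ZMod 3) n := fun s i y => P ⟨s, lt_trans s.isLt ht⟩ i (emb y)
      have hQ : ∀ s i, Q s i ∈ Smolensky.lowDeg (ZMod 3) n D := fun s i =>
        Smolensky.comp_subst_mem_lowDeg emb hemb (hP _ i)
      -- the foreign win event of the processed rings on this fibre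
      set E := univ.filter fun y : Fin n → Bool =>
        ∀ s : Fin t, RingHLF.Rel (w s) (fun i => decide (Q s i y = 1)) with hEdef
      have hE : (univ.filter fun y : Fin n → Bool =>
          ∀ s : Fin m, (s : ℕ) < t → Win s (Function.update X j y)) = E := by
        ext y
        simp only [hEdef, mem_filter, mem_univ, true_and]
        constructor
        · intro hy s
          have h1 := hy ⟨s, lt_trans s.isLt ht⟩ s.isLt
          simp only [Win, hupd_ne X y ⟨s, lt_trans s.isLt ht⟩ s.isLt] at h1
          exact h1
        · intro hy s hs
          have h1 := hy ⟨s, hs⟩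
          simp only [Win, hupd_ne X y s hs]
          exact h1
      have hEW : (univ.filter fun y : Fin n → Bool =>
          ∀ s : Fin m, (s : ℕ) < t + 1 → Win s (Function.update X j y))
          = E.filter fun y => RingHLF.Rel y (fun i => decide (Pv i y = 1)) := by
        ext y
        simp only [hEdef, mem_filter, mem_univ, true_and]
        constructor
        · intro hy
          refine ⟨fun s => ?_, ?_⟩
          · have h1 := hy ⟨s, lt_trans s.isLt ht⟩ (Nat.lt_succ_of_lt s.isLt)
            simp only [Win, hupd_ne X y ⟨s, lt_trans s.isLt ht⟩ s.isLt] at h1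
            exact h1
          · have h1 := hy j (Nat.lt_succ_self t)
            simp only [Win, Function.update_self] at h1
            exact h1
        · rintro ⟨hy1, hy2⟩ s hs
          rcases Nat.lt_succ_iff_lt_or_eq.mp hs with hs' | hs'
          · have h1 := hy1 ⟨s, hs'⟩
            simp only [Win, hupd_ne X y s hs']
            exact h1
          · have hsj : s = j := Fin.ext hs'
            rw [hsj]
            simp only [Win, Function.update_self]
            exact hy2
      -- counts on the fibre
      have hsplit := Finset.card_filter_add_card_filter_not (s := E)
        (fun y : Fin n → Bool => RingHLF.Rel y (fun i => decide (Pv i y = 1)))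
      have hsum : ((E.filter fun y : Fin n → Bool => RingHLF.Rel y (fun i => decide (Pv i y = 1))).card : ℝ)
          + ((E.filter fun y : Fin n → Bool => ¬ RingHLF.Rel y (fun i => decide (Pv i y = 1))).card : ℝ)
            = (E.card : ℝ) := by exact_mod_cast hsplit
      have heN : (E.card : ℝ) ≤ N := by
        rw [← hcardY]; exact_mod_cast Finset.card_le_univ E
      have hsp : (1 - η) * N ≤ (E.card : ℝ) →
          d * N ≤ ((E.filter fun y : Fin n → Bool => ¬ RingHLF.Rel y (fun i => decide (Pv i y = 1))).card : ℝ) := by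
        intro hle
        have h1 := hS Pv hPv t ht w Q hQ (by rw [hEdef] at hle; exact hle)
        rw [hEdef, Finset.filter_filter]
        exact h1
      rw [hEW, hE]
      exact fibre_decrement hsum heN (by positivity) hN0 hd0 hη1 hsp
    -- sum the fibrewise bound over all tuples
    have hL : ∑ X : Fin m → Fin n → Bool, ((univ.filter fun y : Fin n → Bool =>
          ∀ s : Fin m, (s : ℕ) < t + 1 → Win s (Function.update X j y)).card : ℝ)
        = N * ((A (t + 1)).card : ℝ) := by
      have h1 := sum_card_filter_update j (fun Z : Fin m → Fin n → Bool => ∀ s : Fin m, (s : ℕ) < t + 1 → Win s Z)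
      rw [← hcardY]
      exact_mod_cast h1
    have hR : ∑ X : Fin m → Fin n → Bool, ((univ.filter fun y : Fin n → Bool =>
          ∀ s : Fin m, (s : ℕ) < t → Win s (Function.update X j y)).card : ℝ)
        = N * ((A t).card : ℝ) := by
      have h1 := sum_card_filter_update j (fun Z : Fin m → Fin n → Bool => ∀ s : Fin m, (s : ℕ) < t → Win s Z)
      rw [← hcardY]
      exact_mod_cast h1
    have hsumle : N * ((A (t + 1)).card : ℝ)
        ≤ (1 - d) * (N * ((A t).card : ℝ)) + M * (d * ((1 - η) * N)) := by
      rw [← hL, ← hR, Finset.mul_sum, ← hcardX, ← Finset.card_univ, ← nsmul_eq_mul, ← Finset.sum_const,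
        ← Finset.sum_add_distrib]
      exact Finset.sum_le_sum fun X _ => hfib X
    -- divide by N
    have hkey : N * ((A (t + 1)).card : ℝ) ≤ N * ((1 - d) * ((A t).card : ℝ) + d * ((1 - η) * M)) := by
      calc N * ((A (t + 1)).card : ℝ) ≤ (1 - d) * (N * ((A t).card : ℝ)) + M * (d * ((1 - η) * N)) := hsumle
        _ = N * ((1 - d) * ((A t).card : ℝ) + d * ((1 - η) * M)) := by ring
    exact le_of_mul_le_mul_left hkey hNpos
  -- iterate
  have hind : ∀ t : ℕ, t ≤ m → ((A t).card : ℝ) ≤ ((1 - η) + η * (1 - d) ^ t) * M := by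
    intro t
    induction t with
    | zero =>
      intro _
      have hA0 : A 0 = univ := by
        ext X
        simp [A]
      rw [hA0, Finset.card_univ, hcardX]
      ring_nf
      exact le_rfl
    | succ t ih =>
      intro ht
      have ht' : t < m := Nat.lt_of_succ_le ht
      have h1d : 0 ≤ 1 - d := by linarith
      calc ((A (t + 1)).card : ℝ) ≤ (1 - d) * ((A t).card : ℝ) + d * ((1 - η) * M) := hstep t ht'
        _ ≤ (1 - d) * (((1 - η) + η * (1 - d) ^ t) * M) + d * ((1 - η) * M) :=
            add_le_add (mul_le_mul_of_nonneg_left (ih ht'.le) h1d) le_rfl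
        _ = ((1 - η) + η * (1 - d) ^ (t + 1)) * M := by ring
  have hAm : winAllSet P = A m := by
    ext X
    simp only [winAllSet, A, Win, mem_filter, mem_univ, true_and]
    exact ⟨fun h s _ => h s, fun h s => h s s.isLt⟩
  rw [hAm]
  exact hind m le_rfl

/-- `(1 - 1/n^k)^(n^k) ≤ 1/2` for `n ≥ 1` (`(1-x)^N ≤ e^{-xN} = e^{-1} < 1/2`). [arithmetic] -/
theorem decay_le_half {n k : ℕ} (hn : 1 ≤ n) : (1 - 1 / (n : ℝ) ^ k) ^ (n ^ k) ≤ 1 / 2 := by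
  have hn1 : (1 : ℝ) ≤ n := by exact_mod_cast hn
  have hnpos : (0 : ℝ) < n := by linarith
  set d : ℝ := 1 / (n : ℝ) ^ k with hd
  have hd0 : 0 ≤ d := by positivity
  have hd1 : d ≤ 1 := by rw [hd, div_le_one (by positivity)]; exact one_le_pow₀ hn1
  have hdm : d * ((n ^ k : ℕ) : ℝ) = 1 := by
    rw [hd]; push_cast; field_simp
  calc (1 - d) ^ (n ^ k) ≤ (Real.exp (-d)) ^ (n ^ k) := by
        apply pow_le_pow_left₀ (by linarith) (by linarith [Real.add_one_le_exp (-d)])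
    _ = Real.exp (-(d * ((n ^ k : ℕ) : ℝ))) := by
        rw [← Real.exp_nat_mul]; congr 1; ring
    _ = Real.exp (-1) := by rw [hdm]
    _ ≤ 1 / 2 := by
        rw [Real.exp_neg, inv_eq_one_div]
        apply one_div_le_one_div_of_le (by norm_num)
        linarith [Real.add_one_le_exp (1 : ℝ)]

/-- **the bridge at one degree exponent** (explicit binders, no new `Prop`): the spread hypothesis at lengths `≥ n₀`
with parameters `η ∈ (0,1]`, `k`, degree `δ n` gives, at every length `n ≥ max n₀ 1`, the many-ring win bound
`#winAll ≤ (1 - η/2)·2^(n^k·n)` for joint strategies of degree `≤ δ n` on `n^k` rings. [kernel] -/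
theorem card_winAllSet_le_of_spread {η : ℝ} (hη : 0 < η) (hη1 : η ≤ 1) {k : ℕ} {δ : ℕ → ℕ} {n₀ : ℕ}
    (hS : ∀ n ≥ n₀, ∀ Pv : Fin n → Smolensky.CubeFn (ZMod 3) n, (∀ i, Pv i ∈ Smolensky.lowDeg (ZMod 3) n (δ n)) →
      ∀ t : ℕ, t ≤ n ^ k → ∀ w : Fin t → Fin n → Bool, ∀ Q : Fin t → Fin n → Smolensky.CubeFn (ZMod 3) n,
        (∀ s i, Q s i ∈ Smolensky.lowDeg (ZMod 3) n (δ n)) →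
        (1 - η) * (2 : ℝ) ^ n ≤ ((univ.filter fun y : Fin n → Bool =>
            ∀ s, RingHLF.Rel (w s) (fun i => decide (Q s i y = 1))).card : ℝ) →
        1 / (n : ℝ) ^ k * (2 : ℝ) ^ n ≤ ((univ.filter fun y : Fin n → Bool =>
            (∀ s, RingHLF.Rel (w s) (fun i => decide (Q s i y = 1))) ∧
              ¬ RingHLF.Rel y (fun i => decide (Pv i y = 1))).card : ℝ))
    {n : ℕ} (hn : max n₀ 1 ≤ n) (P : JointStrategy (n ^ k) n)
    (hP : ∀ j i, P j i ∈ Smolensky.lowDeg (ZMod 3) (n ^ k * n) (δ n)) :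
    ((winAllSet P).card : ℝ) ≤ (1 - η / 2) * (2 : ℝ) ^ (n ^ k * n) := by
  have hnn₀ : n₀ ≤ n := le_of_max_le_left hn
  have hn1 : 1 ≤ n := le_of_max_le_right hn
  have hn1r : (1 : ℝ) ≤ n := by exact_mod_cast hn1
  have hd0 : (0 : ℝ) ≤ 1 / (n : ℝ) ^ k := by positivity
  have hd1 : 1 / (n : ℝ) ^ k ≤ 1 := by
    rw [div_le_one (by positivity)]; exact one_le_pow₀ hn1r
  have hyb := card_winAllSet_le_hybrid hη1 hd0 hd1 P hP
    (fun Pv hPv t ht w Q hQ => hS n hnn₀ Pv hPv t ht.le w Q hQ)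
  refine le_trans hyb (mul_le_mul_of_nonneg_right ?_ (by positivity))
  have hq := decay_le_half (k := k) hn1
  nlinarith [mul_le_mul_of_nonneg_left hq hη.le]

end SpreadBridge

/-- **Item stmt-QuantumAdvantage-29066 `SpreadBridge3` PROVED** (the verbatim route item, by exact type):
`SpreadLoss3 → MultiRingHard3` with `K := k`, `θ := 1 - min η 1 / 2`. -/
theorem spreadDial_spreadBridge3 : Theses.SpreadDial.SpreadBridge3 := by
  rintro ⟨η, hη, k, hk⟩
  have hη' : 0 < min η 1 := lt_min hη one_pos
  refine ⟨k, 1 - min η 1 / 2, by linarith, fun c => ?_⟩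
  obtain ⟨n₀, hn₀⟩ := hk c
  refine ⟨max n₀ 1, fun n hn P hP => ?_⟩
  have h := SpreadBridge.card_winAllSet_le_of_spread (δ := fun n => (Nat.log 2 n) ^ c) (k := k) (n₀ := n₀)
    hη' (min_le_right η 1) (fun n hn Pv hPv t ht w Q hQ hdens => hn₀ n hn Pv hPv t ht w Q hQ
      (le_trans (mul_le_mul_of_nonneg_right (by linarith [min_le_left η 1]) (by positivity)) hdens)) hn P hP
  exact h

/-- **SpreadDial's `closes` with BOTH bridge binders discharged**: `PolyLoss3 → CoverLift3 → AdviceFreeQNC0Three`. -/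
theorem spreadDial_closes₂ (hP : Theses.SpreadDial.PolyLoss3) (hC : Theses.SpreadDial.CoverLift3) :
    Summit.QuantumAdvantage.AdviceFreeQNC0.AdviceFreeQNC0Three :=
  Theses.SpreadDial.closes hP hC spreadDial_spreadBridge3 spreadDial_multiRingBridge3

/-- corollary: `SpreadLoss3` ALONE gives the leaf (SpreadLoss3 ⇒ MultiRingHard3 ⇒ leaf, via the landed
`adviceFreeQNC0Three_of_multiRingHard3`; `Theses.SpreadDial.MultiRingHard3` and `Theses.ProductDial.MultiRingHard3` are the
same term). -/
theorem adviceFreeQNC0Three_of_spreadLoss3 (h : Theses.SpreadDial.SpreadLoss3) :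
    Summit.QuantumAdvantage.AdviceFreeQNC0.AdviceFreeQNC0Three :=
  adviceFreeQNC0Three_of_multiRingHard3 (spreadDial_spreadBridge3 h)

end Summit.QuantumAdvantage.QuantumAdvantage.Theorems
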